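import Summits.RiemannHypothesis.RiemannHypothesis.Theorems.SignConeConeMagnificationPoissonDigamma
import Summits.RiemannHypothesis.RiemannHypothesis.Theorems.SignConeConeMagnificationTorusSummable
import Summits.RiemannHypothesis.RiemannHypothesis.Theorems.SignConeConeMagnificationCalibration

/-!
# `SignCone.ConeMagnification`, line `Sketch` (r4): the open core in Poisson form — equivalence with r3,
# special cases and calibration transferred
(crux stmt-RiemannHypothesis-16303; HELPER file, `--supports`)

By the bridge `poissonArch_eq_half_re_digamma` (`…PoissonDigamma.lean`: the Poisson form `𝒜(s)` of the archimedean
majorant equals `½ Re ψ(s/2)` on `Re s > 1/2`) the registered open stub `stub_torusOfCara` of skeleton r4 is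
EQUIVALENT to its r3 form (`stub_torusOfCara_poisson_iff_digamma`), and the results landed against the r3 form transfer
verbatim to the registered signature:

* `torusOfCara_of_eventually_vonMangoldt_poisson` — the r4 stub for every finitely supported modification of `Λ`
  (from p133361);
* `torusOfCara_of_summable_poisson` — the r4 stub for every `ℓ¹(1/√n)`-modification of `Λ` (from p133660);
* `exists_large_re_riemannZeta0_of_stub_torusOfCara_poisson` — CALIBRATION: the r4 stub, as stated, implies the
  `Ω₊`-statement `∃ s, Re s > 1/2, Re(ζ₀(s) − 1) > 1/2 + Re(1/s) + ½Re ψ(s/2) − ½log π` for `ζ` in the strip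
  (from p132538), so any proof of it contains a large-values theorem for `Re ζ` (resonance method).

What remains open is unchanged: the non-`ℓ¹(1/√n)` regime of `c − Λ`.
-/

noncomputable section

-- `Summit.RiemannHypothesis.RiemannHypothesis.…` repeats a namespace component by design (D-0017 layout).
set_option linter.dupNamespace false

open scoped BigOperators
open Complex MeasureTheory Set Filter

namespace Summit.RiemannHypothesis.RiemannHypothesis.Theorems.SignConeConeMagnification

/-- The two forms of the Carathéodory majorant agree pointwise, hence as hypotheses on `F`. [folklore] -/
theorem caraPoisson_iff_caraDigamma (F : ℂ → ℂ) :
    (∀ s : ℂ, 1 / 2 < s.re →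
        (F s).re ≤ 1 / 2 + (1 / s).re +
          1 / (2 * Real.pi) * (∫ v : ℝ, (Complex.digamma (1 / 4 + v / 2 * Complex.I)).re *
            ((s.re - 1 / 2) / ((s.re - 1 / 2) ^ 2 + (s.im - v) ^ 2))) - Real.log Real.pi / 2) ↔
      (∀ s : ℂ, 1 / 2 < s.re →
        (F s).re ≤ 1 / 2 + (1 / s).re + (Complex.digamma (s / 2)).re / 2 - Real.log Real.pi / 2) := by
  refine forall_congr' fun s => forall_congr' fun hs => ?_
  rw [poissonArch_eq_half_re_digamma hs]

/-- The existential Carathéodory hypothesis of the stub in its two forms. [folklore] -/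
theorem exists_caraPoisson_iff (c : ℕ → ℝ) :
    (∃ F : ℂ → ℂ, DifferentiableOn ℂ F {s : ℂ | 1 / 2 < s.re} ∧
        (∀ s : ℂ, 1 < s.re → F s = LSeries (fun n => ((c n : ℝ) : ℂ)) s - 1 / (s - 1)) ∧
        ∀ s : ℂ, 1 / 2 < s.re →
          (F s).re ≤ 1 / 2 + (1 / s).re +
            1 / (2 * Real.pi) * (∫ v : ℝ, (Complex.digamma (1 / 4 + v / 2 * Complex.I)).re *
              ((s.re - 1 / 2) / ((s.re - 1 / 2) ^ 2 + (s.im - v) ^ 2))) - Real.log Real.pi / 2) ↔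
      (∃ F : ℂ → ℂ, DifferentiableOn ℂ F {s : ℂ | 1 / 2 < s.re} ∧
        (∀ s : ℂ, 1 < s.re → F s = LSeries (fun n => ((c n : ℝ) : ℂ)) s - 1 / (s - 1)) ∧
        ∀ s : ℂ, 1 / 2 < s.re →
          (F s).re ≤ 1 / 2 + (1 / s).re + (Complex.digamma (s / 2)).re / 2 - Real.log Real.pi / 2) :=
  exists_congr fun F => and_congr_right fun _ => and_congr_right fun _ => caraPoisson_iff_caraDigamma F

/-- **The registered open stub (r4, Poisson form) is equivalent to its r3 form (`½ Re ψ(s/2)`).** [folklore] -/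
theorem stub_torusOfCara_poisson_iff_digamma :
    (∀ c : ℕ → ℝ, (∀ n, 0 ≤ c n) → c 1 = 0 → (∀ σ : ℝ, 1 < σ → LSeriesSummable (fun n => ((c n : ℝ) : ℂ))
        σ) → (∃ F : ℂ → ℂ, DifferentiableOn ℂ F {s : ℂ | 1 / 2 < s.re} ∧ (∀ s : ℂ, 1 < s.re → F s = LSeries
        (fun n => ((c n : ℝ) : ℂ)) s - 1 / (s - 1)) ∧ ∀ s : ℂ, 1 / 2 < s.re → (F s).re ≤ 1 / 2 + (1 / s).re
        + 1 / (2 * Real.pi) * (∫ v : ℝ, (Complex.digamma (1 / 4 + v / 2 * Complex.I)).re * ((s.re - 1 / 2)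
        / ((s.re - 1 / 2) ^ 2 + (s.im - v) ^ 2))) - Real.log Real.pi / 2) → ∀ S : Finset ℕ, (∀ p ∈ S,
        p.Prime) → ∀ φ : ℝ, ∑ A ∈ S.powerset, (c (∏ p ∈ A, p) - ArithmeticFunction.vonMangoldt (∏ p ∈ A,
        p)) / Real.sqrt (∏ p ∈ A, (p : ℝ)) * (1 / 2) ^ A.card * Real.cos ((A.card : ℝ) * φ) ≤ 1 / 2) ↔
    (∀ c : ℕ → ℝ, (∀ n, 0 ≤ c n) → c 1 = 0 → (∀ σ : ℝ, 1 < σ → LSeriesSummable (fun n => ((c n : ℝ) : ℂ))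
        σ) → (∃ F : ℂ → ℂ, DifferentiableOn ℂ F {s : ℂ | 1 / 2 < s.re} ∧ (∀ s : ℂ, 1 < s.re → F s = LSeries
        (fun n => ((c n : ℝ) : ℂ)) s - 1 / (s - 1)) ∧ ∀ s : ℂ, 1 / 2 < s.re → (F s).re ≤ 1 / 2 + (1 / s).re
        + (Complex.digamma (s / 2)).re / 2 - Real.log Real.pi / 2) → ∀ S : Finset ℕ, (∀ p ∈ S, p.Prime) → ∀
        φ : ℝ, ∑ A ∈ S.powerset, (c (∏ p ∈ A, p) - ArithmeticFunction.vonMangoldt (∏ p ∈ A, p)) / Real.sqrt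
        (∏ p ∈ A, (p : ℝ)) * (1 / 2) ^ A.card * Real.cos ((A.card : ℝ) * φ) ≤ 1 / 2) := by
  constructor
  · intro H c hc0 hc1 hsum hF S hS φ
    exact H c hc0 hc1 hsum ((exists_caraPoisson_iff c).2 hF) S hS φ
  · intro H c hc0 hc1 hsum hF S hS φ
    exact H c hc0 hc1 hsum ((exists_caraPoisson_iff c).1 hF) S hS φ

/-- **The r4 stub for finitely supported modifications of `Λ`** (registered signature + `∃ N, ∀ n ≥ N, c n = Λ n`),
from `torusOfCara_of_eventually_vonMangoldt` (p133361) through the bridge. [folklore] -/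
theorem torusOfCara_of_eventually_vonMangoldt_poisson :
    ∀ c : ℕ → ℝ, (∀ n, 0 ≤ c n) → c 1 = 0 → (∀ σ : ℝ, 1 < σ → LSeriesSummable (fun n => ((c n : ℝ) : ℂ)) σ)
        → (∃ N : ℕ, ∀ n : ℕ, N ≤ n → c n = ArithmeticFunction.vonMangoldt n) → (∃ F : ℂ → ℂ,
        DifferentiableOn ℂ F {s : ℂ | 1 / 2 < s.re} ∧ (∀ s : ℂ, 1 < s.re → F s = LSeries (fun n => ((c n :
        ℝ) : ℂ)) s - 1 / (s - 1)) ∧ ∀ s : ℂ, 1 / 2 < s.re → (F s).re ≤ 1 / 2 + (1 / s).re + 1 / (2 *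
        Real.pi) * (∫ v : ℝ, (Complex.digamma (1 / 4 + v / 2 * Complex.I)).re * ((s.re - 1 / 2) / ((s.re -
        1 / 2) ^ 2 + (s.im - v) ^ 2))) - Real.log Real.pi / 2) → ∀ S : Finset ℕ, (∀ p ∈ S, p.Prime) → ∀ φ :
        ℝ, ∑ A ∈ S.powerset, (c (∏ p ∈ A, p) - ArithmeticFunction.vonMangoldt (∏ p ∈ A, p)) / Real.sqrt (∏
        p ∈ A, (p : ℝ)) * (1 / 2) ^ A.card * Real.cos ((A.card : ℝ) * φ) ≤ 1 / 2 := by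
  intro c hc0 hc1 hsum hev hF
  exact torusOfCara_of_eventually_vonMangoldt c hc0 hc1 hsum hev ((exists_caraPoisson_iff c).1 hF)

/-- **The r4 stub for `ℓ¹(1/√n)`-modifications of `Λ`** (registered signature + `Summable (|c n − Λ n|/√n)`),
from `torusOfCara_of_summable` (p133660) through the bridge. [folklore] -/
theorem torusOfCara_of_summable_poisson :
    ∀ c : ℕ → ℝ, (∀ n, 0 ≤ c n) → c 1 = 0 → (∀ σ : ℝ, 1 < σ → LSeriesSummable (fun n => ((c n : ℝ) : ℂ)) σ)
        → Summable (fun n : ℕ => |c n - ArithmeticFunction.vonMangoldt n| / Real.sqrt n) → (∃ F : ℂ → ℂ,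
        DifferentiableOn ℂ F {s : ℂ | 1 / 2 < s.re} ∧ (∀ s : ℂ, 1 < s.re → F s = LSeries (fun n => ((c n :
        ℝ) : ℂ)) s - 1 / (s - 1)) ∧ ∀ s : ℂ, 1 / 2 < s.re → (F s).re ≤ 1 / 2 + (1 / s).re + 1 / (2 *
        Real.pi) * (∫ v : ℝ, (Complex.digamma (1 / 4 + v / 2 * Complex.I)).re * ((s.re - 1 / 2) / ((s.re -
        1 / 2) ^ 2 + (s.im - v) ^ 2))) - Real.log Real.pi / 2) → ∀ S : Finset ℕ, (∀ p ∈ S, p.Prime) → ∀ φ :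
        ℝ, ∑ A ∈ S.powerset, (c (∏ p ∈ A, p) - ArithmeticFunction.vonMangoldt (∏ p ∈ A, p)) / Real.sqrt (∏
        p ∈ A, (p : ℝ)) * (1 / 2) ^ A.card * Real.cos ((A.card : ℝ) * φ) ≤ 1 / 2 := by
  intro c hc0 hc1 hsum hl1 hF
  exact torusOfCara_of_summable c hc0 hc1 hsum hl1 ((exists_caraPoisson_iff c).1 hF)

/-- **Calibration of the r4 stub**: as stated (Poisson form), `stub_torusOfCara` implies
`∃ s, Re s > 1/2 ∧ 1/2 + Re(1/s) + ½Re ψ(s/2) − ½log π < Re(ζ₀(s) − 1)` — an `Ω₊`-theorem for `Re ζ` in the strip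
beyond the archimedean density (from `exists_large_re_riemannZeta0_of_stub_torusOfCara`, p132538, through the
bridge). [folklore] -/
theorem exists_large_re_riemannZeta0_of_stub_torusOfCara_poisson :
    (∀ c : ℕ → ℝ, (∀ n, 0 ≤ c n) → c 1 = 0 → (∀ σ : ℝ, 1 < σ → LSeriesSummable (fun n => ((c n : ℝ) : ℂ))
        σ) → (∃ F : ℂ → ℂ, DifferentiableOn ℂ F {s : ℂ | 1 / 2 < s.re} ∧ (∀ s : ℂ, 1 < s.re → F s = LSeries
        (fun n => ((c n : ℝ) : ℂ)) s - 1 / (s - 1)) ∧ ∀ s : ℂ, 1 / 2 < s.re → (F s).re ≤ 1 / 2 + (1 / s).re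
        + 1 / (2 * Real.pi) * (∫ v : ℝ, (Complex.digamma (1 / 4 + v / 2 * Complex.I)).re * ((s.re - 1 / 2)
        / ((s.re - 1 / 2) ^ 2 + (s.im - v) ^ 2))) - Real.log Real.pi / 2) → ∀ S : Finset ℕ, (∀ p ∈ S,
        p.Prime) → ∀ φ : ℝ, ∑ A ∈ S.powerset, (c (∏ p ∈ A, p) - ArithmeticFunction.vonMangoldt (∏ p ∈ A,
        p)) / Real.sqrt (∏ p ∈ A, (p : ℝ)) * (1 / 2) ^ A.card * Real.cos ((A.card : ℝ) * φ) ≤ 1 / 2) →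
    ∃ s : ℂ, 1 / 2 < s.re ∧
      1 / 2 + (1 / s).re + (Complex.digamma (s / 2)).re / 2 - Real.log Real.pi / 2 < (riemannZeta₀ s - 1).re :=
  fun H => exists_large_re_riemannZeta0_of_stub_torusOfCara (stub_torusOfCara_poisson_iff_digamma.1 H)

end Summit.RiemannHypothesis.RiemannHypothesis.Theorems.SignConeConeMagnification

end
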